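import Summits.BirchSwinnertonDyer.BirchSwinnertonDyer.Theorems.SignedLowerHalvesKobayashiMainConjectureSmallImageTwoVariableInputsNoSurj
import Summits.BirchSwinnertonDyer.BirchSwinnertonDyer.Theorems.SignedLowerHalvesKobayashiMainConjectureSmallImageMuPinning
import Summits.BirchSwinnertonDyer.BirchSwinnertonDyer.Theorems.SignedLowerHalvesKobayashiLowerHalfSemistableMuSplit
import HarnessLib

/-!
# Route `SignedLowerHalves`, crux `KobayashiMainConjectureSmallImage` (item stmt-BirchSwinnertonDyer-19002):
# the two-variable signed descent WITHOUT surjectivity of `ρ̄_{E,p}` — the small-image twin of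
# `SignedBaseChange`'s K2R⁗, delivering the RATIONAL Eisenstein half unconditionally in the image and the
# INTEGRAL Eisenstein half `KobayashiLowerDivisibility W p ε` from ONE analytic `μ`-value (cell `bsd-ssimc`,
# seat `bsd-line-slh-p3` gen 5, line `birth`; THEOREMS ONLY, route-independent; helper file `--supports` item 4)

PARTITION (cell bsd-ssimc): X7 (A7) × item 4's small-image domain (`5 ≤ p`, `ρ̄_{E,p}` not onto — and in
fact every X7 pair at `p ≥ 5`, the theorems below carry NO image hypothesis). Types the designed line «acns»
of this crux (`Cruxes/KobayashiMainConjectureSmallImage/AcnsSketch.lean`, idea card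
`heegner-primitivity-prime-to-p-image` NOTE g3) as kernel theorems modulo its two-variable inputs; closes
none; crux 4 OPEN. BSD is not proved by any of this.

## What the sibling route proves at SURJECTIVE image, and what survives without it

`SignedBaseChange`'s descent crux K2R⁗ (`…SignedBaseChangeK2RAssembly.signedLowerDescent_of_prop422_of_package`,
p533062) turns the canonical twist-pair Greenberg product package (K1″) of an X7 pair `(W, p)`, `p ≥ 5`,
with `Surj W p`, into the Eisenstein half `∀ ε, KobayashiLowerDivisibility W p ε`. `Surj W p` is consumed at
exactly three places: (i) (irr_K) for `W`, `W'` over the auxiliary field `K` (binder of BCS 2025 Prop. 4.2.2);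
(ii) absolute irreducibility of every framing of `W'_K[p]` (image clause of the BSTW signed package at `f'`);
(iii) Kobayashi Thm. 4.1 in its INTEGRAL form for the four `ℚ`-curves `E, E^{(D_K)}, E^{(d)}, E^{(dD_K)}`
(the final squeeze to the EQUALITY `char X^ε = (L_p^ε)`).

(i) and (ii) hold WITHOUT any image hypothesis at a good supersingular odd `p` for `K` with `(N, d_K) = 1`
(Serre Prop. 12 + Matar–Nekovář 2019 Prop. 5.26 (2)(3), tree-proved; companion file
`…SmallImageIrrOverCoprimeQuadratic.lean`, p619183). (iii) is not available at small image — Thm. 4.1 gives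
only `gᵢ ∣ p^{nᵢ} L_p^ε` there — and this file records exactly what the descent then yields:

* `muZero_of_prop422GreenbergAnyRoot_noSurj`, `productLowerDivisibility_of_package_noSurj` — the two K2R⁗
  inputs (S1) `μ(G⁻) = μ(G'⁻) = 0` and (S3) `L^ε(f)L^ε(f₂)L^ε(f')L^ε(f₄) ∣ g₁g₂g₃g₄`, VERBATIM their tree
  statements (`…K2RMuZero.stub_muZero_of_prop422GreenbergAnyRoot`, `…K2RTransferDescent.productLowerDivisibility_of_package`)
  with the binder `Surj W p →` DELETED (the proofs are the tree's, with (i)/(ii) re-sourced).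
* `rationalLowerDivisibility_of_package_noSurj` — **for every X7 pair at `p ≥ 5` carrying the K1″ package
  (NO image hypothesis): for every sign `ε` and every admissible cyclotomic datum, Pollack pair and signed
  Selmer datum, `char X^ε = (g)` with `L_p^ε ∣ p^t · g` for some `t`** — the Eisenstein half in `Λ ⊗ ℚ_p`
  (the «rational part» of the μ-split `MuSplit.kobayashiLowerDivisibility_iff_dvd_C_pow_mul_and_mu_le`),
  from the product divisibility and the RATIONAL Kato bounds of the three auxiliary curves only
  (`SmallImageMuPinning.dvd_C_pow_mul_of_mul4_dvd`).
* `kobayashiLowerDivisibility_of_package_of_mu_noSurj` — **plus ONE analytic value `μ(L_p^ε(E)) = 0` (for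
  `E` itself, at the sign `ε`; no `μ` of the twists) and the published period unit: `KobayashiLowerDivisibility W p ε`**
  — the registered stub `stub_lowerSmallImage` of line `birth` at that sign, modulo the package.

So on item 4's domain the designed line «acns» (T1 `AcDivNs` ∧ T2 `ES2Ns` ⇒ T3 `CanonicalNs` = the K1″
package, by the landed acanchor glue pattern) closes birth's `stub_lowerSmallImage` modulo EXACTLY the
ONE-SIGN analytic `μ`-rider of the crux's own curve (idea card `onesign-mu-cuspidal-generation`:
`min(μ⁺(E), μ⁻(E)) = 0` gives the `∃ ε`) — and NOT the equality: `μ(g)` stays free, which is the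
registered `stub_saturationSmallImage`. HONEST SCOPE: CONDITIONAL on the K1″-shaped package (OPEN: its
«acns» engines L1/L2 are not in print at normaliser-of-Cartan image), on the PRE binders
`props118_27_519_…_PRE` / `thm617_…_PRE`, and on BCS Prop. 4.2.2 by name; nothing of them is asserted.

References: [BurungaleSkinnerTianWan2024] arXiv:2409.01350v2 §2.3 (proof of Thm. (KoMC_r)), Props. 1.18,
2.7, 5.19, Thm. 6.17; [BurungaleCastellaSkinner2025] Prop. 4.2.2; [Kobayashi2003] Conjecture (p. 2), Thm. 1.2,
Thm. 4.1; [MatarNekovar2019] Prop. 5.26 (2)(3); [GreenbergVatsal2000] p. 4, §3 Rem. 3.4; [Pollack2003]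
Conj. 6.3; tree: K2R⁗ files of `bsd-wall-sbc-p2`, `MuSplit` (slh-p2 gen 3), `AcnsSketch.lean` (bsd-idea-13 g3).
-/

set_option autoImplicit false
-- justification: the layout's summit-side namespace for a single-conjunct summit (Sub = Summit) repeats the
-- component `BirchSwinnertonDyer`; helper files live under `Summit.<S>.<Sub>.Theorems`.
set_option linter.dupNamespace false

noncomputable section

open scoped Classical MatrixGroups ModularForm

open CongruenceSubgroup WeierstrassCurve NumberField IsDedekindDomain Field
  Literature.NumberTheory.GaloisRepresentations Literature.NumberTheory.EllipticCurves
  Literature.NumberTheory.EllipticCurves.ModularForms Literature.NumberTheory.EllipticCurves.Rank1Residual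
  Literature.NumberTheory.EllipticCurves.BurungaleSkinnerTianWan2024
  Literature.NumberTheory.EllipticCurves.BurungaleCastellaSkinner2025
  Literature.NumberTheory.EllipticCurves.GreenbergVatsal2000 Literature.NumberTheory.EllipticCurves.UnrSeries₂
  Literature.NumberTheory.EllipticCurves.Kobayashi2003 ZpExtension
  Summit.BirchSwinnertonDyer.Rank1Residual.Supersingular
  Summit.BirchSwinnertonDyer.BirchSwinnertonDyer.Theorems.SignedBaseChangeEisensteinSqueeze

namespace Summit.BirchSwinnertonDyer.BirchSwinnertonDyer.Theorems.SmallImageAcnsDescent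

open Summit.BirchSwinnertonDyer.BirchSwinnertonDyer.Theorems.SmallImageTwoVariableInputsNoSurj

/-! ## §4. The descent WITHOUT `Surj`: rational Eisenstein half for free, integral from ONE `μ` -/

/-- **The RATIONAL Eisenstein half from the K1″ package — NO image hypothesis, NO `μ`.** Granted BY NAME BCS
Prop. 4.2.2 (`h422`) and the BSTW two-variable signed package (`hpkg`), Kobayashi Thm. 4.1 / Thm. 1.2,
modularity-with-parametrisation and the BSTW common-frame binder GSF (`thm617_…_PRE`): for EVERY globally
minimal `W/ℚ` in class X7 at `p ≥ 5` (surjective image or not) carrying the canonical twist-pair Greenberg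
product package of K1″ `TwistPairGreenbergProductDivisibilityCanonical` (its `∃`-body VERBATIM), for every sign
`ε`, every canonical cyclotomic datum `(κ, γ)`, the conductor-level newform `f` of `W`, every Pollack pair and
every signed Selmer datum `D`: **`char X^ε(E/ℚ_∞) = (g)` with `L_p^ε ∣ p^t · g` for some `t`**. Proof = the
tree's K2R⁗ assembly (p533062) up to the product divisibility `L₁L₂L₃L₄ ∣ g₁g₂g₃g₄`, then the RATIONAL Kato
bounds `gᵢ ∣ p^{nᵢ}Lᵢ` of the three auxiliary curves only (`thm41….exists_dvd_pow_mul`, no image clause) and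
`SmallImageMuPinning.dvd_C_pow_mul_of_mul4_dvd`. This is the «rational part» of `KobayashiLowerDivisibility W p ε`
in the μ-split (`MuSplit.kobayashiLowerDivisibility_iff_dvd_C_pow_mul_and_mu_le`).
[cite: BurungaleSkinnerTianWan2024, §2.3 proof of Thm. (KoMC_r) (arXiv v2 TeX store p0076 L36–L65) (the assembly; the preprint enters only as the OPEN binders)]
[cite: Kobayashi2003, Conjecture (Main Conjecture) (p. 2), Thm. 1.2 (p. 2), Thm. 4.1 first display (p. 8)]
[cite: BurungaleCastellaSkinner2025, Prop. 4.2.2 (§4.2, p. 9 of arXiv:2405.00270v2)] -/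
theorem rationalLowerDivisibility_of_package_noSurj
    (h422 : prop422_greenbergAnyRoot_hasUnitContent_minus)
    (hpkg : props118_27_519_exists_signedTwoVariablePackage_supersingular_PRE) :
    Literature.NumberTheory.EllipticCurves.Kobayashi2003.thm41_signedCharIdeal_divisibility → Literature.NumberTheory.EllipticCurves.Kobayashi2003.thm12_signedSelmerDual_finite_torsion → Literature.NumberTheory.EllipticCurves.ModularForms.nonempty_modularParametrizationData → Literature.NumberTheory.EllipticCurves.BurungaleSkinnerTianWan2024.thm617_exists_commonKatzFrame_isGreenbergLFunctionAnyRoot₂_supersingular_PRE → ∀ (W : WeierstrassCurve ℚ) [W.IsElliptic] [W.IsGloballyMinimal] (p : ℕ) [Fact p.Prime], 5 ≤ p → Literature.NumberTheory.EllipticCurves.Rank1Residual.ClassX7 W p → (∃ (K : Type) (_ : Field K) (_ : NumberField K) (ι : PadicAlgCl p ≃+* ℂ) (v vbar : IsDedekindDomain.HeightOneSpectrum (NumberField.RingOfIntegers K)) (κ₁ κ₂ : Literature.NumberTheory.EllipticCurves.ZpExtension K p) (γ₁ γ₂ : Field.absoluteGaloisGroup K) (_ : Fact (Literature.NumberTheory.EllipticCurves.ZpExtension.IsTopGeneratorPair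 κ₁ κ₂ γ₁ γ₂)) (_ : NeZero (NumberField.discr K).natAbs) (N : ℕ) (_ : NeZero N) (f : CuspForm (CongruenceSubgroup.Gamma0 N) 2) (d : ℤ) (W' : WeierstrassCurve ℚ) (_ : W'.IsElliptic) (_ : W'.IsGloballyMinimal) (C : WeierstrassCurve.VariableChange ℚ) (N' : ℕ) (_ : NeZero N') (f' : CuspForm (CongruenceSubgroup.Gamma0 N') 2), Literature.NumberTheory.EllipticCurves.ModularForms.IsNewformOf W f ∧ (N : ℤ) = W.conductorNorm ℤ ∧ Literature.NumberTheory.EllipticCurves.ModularForms.IsNewformOf W' f' ∧ (N' : ℤ) = W'.conductorNorm ℤ ∧ Squarefree d ∧ 1 < d ∧ (∀ q : ℕ, q.Prime → Literature.NumberTheory.EllipticCurves.BurungaleSkinnerTianWan2024.RamifiedInQuadratic d q → q ≠ p ∧ ¬ q ∣ N ∧ ¬ (q : ℤ) ∣ NumberField.discr K) ∧ C • W' = W.quadraticTwist (d : ℚ) ∧ Literature.NumberTheory.EllipticCurves.IsImaginaryQuadratic K ∧ ((Ideal.span {(p : ℤ)}).primesOver (NumberField.RingOfIntegers K)).ncard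 = 2 ∧ ((p : ℕ) : NumberField.RingOfIntegers K) ∈ v.asIdeal ∧ ((p : ℕ) : NumberField.RingOfIntegers K) ∈ vbar.asIdeal ∧ vbar ≠ v ∧ (∀ (w : NumberField.InfinitePlace K) (k : NumberField.RingOfIntegers K), k ∈ v.asIdeal ↔ ‖ι.symm (w.embedding (k : K))‖ < 1) ∧ IsCoprime (N : ℤ) (NumberField.discr K) ∧ (∀ ℓ : ℕ, ℓ.Prime → ℓ ∣ N → ((Ideal.span {(ℓ : ℤ)}).primesOver (NumberField.RingOfIntegers K)).ncard = 2) ∧ (∀ ℓ : ℕ, ℓ.Prime → (ℓ : ℤ) ∣ d → ((Ideal.span {(ℓ : ℤ)}).primesOver (NumberField.RingOfIntegers K)).ncard = 2) ∧ ((Ideal.span {(2 : ℤ)}).primesOver (NumberField.RingOfIntegers K)).ncard = 2 ∧ (∀ ρ : Literature.NumberTheory.GaloisRepresentations.ModPGaloisRep K (ZMod p) 2, (W.baseChange K).IsTorsionGaloisRep p ρ → Literature.NumberTheory.GaloisRepresentations.FramedRep.IsAbsolutelyIrreducible ρ) ∧ κ₁.IsCyclotomic ∧ κ₂.IsAnticyclotomic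 ∧ (∃ ζ : ℤ_[p]ˣ, IsOfFinOrder ζ ∧ ((Literature.NumberTheory.GaloisRepresentations.GaloisRep.cyclotomicCharacter K p γ₁ * ζ : ℤ_[p]ˣ) : ℤ_[p]) = (Literature.NumberTheory.EllipticCurves.cyclotomicGenerator p : ℤ_[p])) ∧ ∀ (Ω δ : ℂ) (Ωp : (Literature.NumberTheory.EllipticCurves.unrIntegers p)ˣ) (LK G G' : PowerSeries (PowerSeries (PadicComplexInt p))), Ω ≠ 0 → (δ ^ 2 = (NumberField.discr K : ℂ) ∨ δ ^ 2 = -(NumberField.discr K : ℂ)) → Literature.NumberTheory.EllipticCurves.IsKatzMeasure₂ ι v vbar ∅ κ₁ κ₂ γ₁⁻¹ γ₂⁻¹ 1 Ω δ ((Ωp : Literature.NumberTheory.EllipticCurves.unrIntegers p) : PadicComplex p) LK → Literature.NumberTheory.EllipticCurves.IsGreenbergLFunctionAnyRoot₂ ι v vbar κ₁ κ₂ γ₁⁻¹ γ₂⁻¹ f (NumberField.discr K).natAbs (NumberField.classNumber K) LK G → Literature.NumberTheory.EllipticCurves.IsGreenbergLFunctionAnyRoot₂ ι v vbar κ₁ κ₂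 γ₁⁻¹ γ₂⁻¹ f' (NumberField.discr K).natAbs (NumberField.classNumber K) LK G' → ∀ J : ℤ_[p] →+* PadicComplexInt p, (∀ x : ℤ_[p], ((J x : PadicComplexInt p) : PadicComplex p) = ((x : ℚ_[p]) : PadicComplex p)) → ∃ s : PowerSeries (PadicComplexInt p), s ≠ 0 ∧ Ideal.span {PowerSeries.map (PowerSeries.C (R := PadicComplexInt p)) s} * ((WeierstrassCurve.XGr₂.charIdeal (W.baseChange K) p κ₁ κ₂ vbar γ₁ γ₂).map (Literature.NumberTheory.EllipticCurves.IwasawaAlgebra₂.toUnr₂ p J) * (WeierstrassCurve.XGr₂.charIdeal (W'.baseChange K) p κ₁ κ₂ vbar γ₁ γ₂).map (Literature.NumberTheory.EllipticCurves.IwasawaAlgebra₂.toUnr₂ p J)) ≤ Ideal.span {G * G'}) →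
    ∀ (ε : ℤˣ) (κ : ZpExtension ℚ p) (γ : Field.absoluteGaloisGroup ℚ),
      κ.IsCyclotomic → κ.IsTopGenerator γ → IsCyclotomicVariable p γ →
    ∀ [NeZero (W.conductorNorm ℤ)] (f : CuspForm (Gamma0 (W.conductorNorm ℤ)) 2), IsNewformOf W f →
    ∀ (Lplus Lminus : IwasawaAlgebra p), IsPollackPair f p Lplus Lminus →
    ∀ (D : SignedSelmerDualData W κ γ ε),
      ∃ (g : IwasawaAlgebra p) (t : ℕ), D.charIdeal = Ideal.span {g} ∧
        kobayashiL ε Lplus Lminus ∣ PowerSeries.C (p : ℤ_[p]) ^ t * g := by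
  intro h41 h12 hmodP hGF W _ _ p _ hp5 hX hP ε κ γ hκ hγ hγ' _ fK hfK Lp Lm hPP D
  obtain ⟨K, iF, iNF, ι, v, vbar, κ₁, κ₂, γ₁, γ₂, iTG, iNZ, N, iN, f, d, W', iE', iM', C, N', iN', f',
    c1, c2, c3, c4, c5, c6, c7, c8, c9, c10, c11, c12, c13, c14, c15, c16, c17, c18, c19, c20, c21, hcan, c22⟩ := hP
  -- the auxiliary curves `W₂ ≃ W^{(D_K)}`, `W₄ ≃ W'^{(D_K)}` (no `Surj`)
  obtain ⟨W₂, W₄, iE₂, iM₂, iE₄, iM₄, C₂, C₄, hC₂, hC₄, ⟨hg₂, ha₂⟩, ⟨hg₃, ha₃⟩, ⟨hg₄, ha₄⟩⟩ :=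
    auxiliaryCurves_noSurj W p hp5 hX K N d W' C c5 c7 c8 c9 c10
  -- ONE common Katz frame with Greenberg functions of `f`, `f'` (GSF on the pair), a structure map `J`
  have hp2 : p ≠ 2 := by omega
  have hpP : p.Prime := Fact.out
  have hgood : W.HasGoodReductionAtPrime p := hX.1.1
  have hap : W.frobeniusTrace p = 0 := ClassX7.frobeniusTrace_eq_zero_of_five_le W p hp5 hX
  have hpN : ¬ (p : ℤ) ∣ W.conductorNorm ℤ := fun h ↦
    (W.dvd_conductorNorm_iff_not_hasGoodReductionAtPrime p).mp (by exact_mod_cast h) hgood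
  have hpN' : ¬ (p : ℤ) ∣ W'.conductorNorm ℤ := fun h ↦
    (W'.dvd_conductorNorm_iff_not_hasGoodReductionAtPrime p).mp (by exact_mod_cast h) hg₃
  have hND' : IsCoprime (N' : ℤ) (NumberField.discr K) :=
    Summit.BirchSwinnertonDyer.BirchSwinnertonDyer.Theorems.SignedBaseChangeK2RTransferDescent.isCoprime_conductorNorm_twist_discr
      W W' c8 c2 c4 K c9.1 (fun q hq hr ↦ (c7 q hq hr).2.2) c18 c15
  obtain ⟨Ω, δ, Ωp, LK, G, G', hΩ, hδ, hLK, hG, hG'⟩ :=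
    exists_commonKatzFrame_greenberg_pair hGF ι K v vbar κ₁ κ₂ γ₁ γ₂ hp5 c9 c10 c11 c12 c13 c14 c20 c21
      W W' c1 c3 c2 hpN hap c15 c4 hpN' ha₃ hND'
  obtain ⟨J, hJ⟩ := exists_structureMap_padicInt (p := p)
  -- the package's product inclusion at this frame, up to a cyclotomic `s ≠ 0`
  obtain ⟨s, hs0, hincl⟩ := c22 Ω δ Ωp LK G G' hΩ hδ hLK hG hG' J hJ
  -- (S1) μ = 0 by name (no `Surj`), (S2) de-localisation (landed)
  obtain ⟨hμ, hμ'⟩ :=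
    muZero_of_prop422GreenbergAnyRoot_noSurj h422 W p hp5 hX K ι v vbar κ₁ κ₂ γ₁ γ₂ N f d W' C N' f'
      c1 c2 c3 c4 c5 c6 c7 c8 c9 c10 c11 c12 c13 c14 c15 c16 c17 c18 c19 c20 c21 Ω δ Ωp LK G G' hΩ hδ hLK hG hG'
  have hfree :=
    Summit.BirchSwinnertonDyer.BirchSwinnertonDyer.Theorems.SignedBaseChangeK2RDelocalisation.stub_delocalise
      p s G G' _ hs0 hμ hμ' hincl
  -- (S3) the package consumer (no `Surj`), for the frame's newforms `f`, `f'`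
  have hPLD :=
    productLowerDivisibility_of_package_noSurj hpkg W p hp5 hX K ι v vbar κ₁ κ₂ γ₁ γ₂ N f d W' C N' f'
      c1 c2 c3 c4 c5 c6 c7 c8 c9 c10 c11 c12 c13 c14 c15 c16 c17 c18 c19 c20 c21 Ω δ Ωp LK G G' hΩ hδ hLK hG hG'
      J hJ hfree hcan W₂ W₄ C₂ C₄ hC₂ hC₄ ε
  -- levels = conductors; the conductor-level newform is `f` (uniqueness)
  have hNn : N = W.conductorNorm ℤ := by exact_mod_cast c2
  subst hNn
  have hfeq : f = fK := c1.unique hfK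
  subst hfeq
  -- generator of `char X^ε(W)`
  obtain ⟨g₁, hg₁⟩ := (charIdeal_isPrincipal_holds p D.X).principal
  have hg₁' : D.charIdeal = Ideal.span {g₁} := hg₁
  -- auxiliary data for `W₂`, `W₄` (newforms by modularity, Pollack pairs, Selmer data, generators); `W'` uses `f'`
  haveI : NeZero (W₂.conductorNorm ℤ) := ⟨(W₂.conductorNorm_pos_holds).ne'⟩
  haveI : NeZero (W₄.conductorNorm ℤ) := ⟨(W₄.conductorNorm_pos_holds).ne'⟩
  obtain ⟨Dm₂⟩ := hmodP W₂
  obtain ⟨Dm₄⟩ := hmodP W₄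
  obtain ⟨Lp₂, Lm₂, hPP₂⟩ :=
    exists_isPollackPair pollack_exists_plusMinusPAdicLFunction_holds hp2 Dm₂.isNewformOf hg₂ ha₂
  obtain ⟨Lp₃, Lm₃, hPP₃⟩ :=
    exists_isPollackPair pollack_exists_plusMinusPAdicLFunction_holds hp2 c3 hg₃ ha₃
  obtain ⟨Lp₄, Lm₄, hPP₄⟩ :=
    exists_isPollackPair pollack_exists_plusMinusPAdicLFunction_holds hp2 Dm₄.isNewformOf hg₄ ha₄
  obtain ⟨D₂⟩ := nonempty_signedSelmerDualData W₂ κ ε hγ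
  obtain ⟨D₃⟩ := nonempty_signedSelmerDualData W' κ ε hγ
  obtain ⟨D₄⟩ := nonempty_signedSelmerDualData W₄ κ ε hγ
  obtain ⟨g₂, hg₂c⟩ := (charIdeal_isPrincipal_holds p D₂.X).principal
  obtain ⟨g₃, hg₃c⟩ := (charIdeal_isPrincipal_holds p D₃.X).principal
  obtain ⟨g₄, hg₄c⟩ := (charIdeal_isPrincipal_holds p D₄.X).principal
  have hg₂' : D₂.charIdeal = Ideal.span {g₂} := hg₂c
  have hg₃' : D₃.charIdeal = Ideal.span {g₃} := hg₃c
  have hg₄' : D₄.charIdeal = Ideal.span {g₄} := hg₄c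
  -- the descent's output at these data: `L₁L₂L₃L₄ ∣ g₁g₂g₃g₄`
  have hprod := hPLD κ γ hκ hγ hγ' Lp Lm hPP D g₁ hg₁' Dm₂.f Dm₂.isNewformOf Lp₂ Lm₂ hPP₂ D₂ g₂ hg₂'
    Lp₃ Lm₃ hPP₃ D₃ g₃ hg₃' Dm₄.f Dm₄.isNewformOf Lp₄ Lm₄ hPP₄ D₄ g₄ hg₄'
  -- Kobayashi Thm. 4.1, RATIONAL form (no image hypothesis), for the three auxiliary curves
  haveI : Module.Finite (IwasawaAlgebra p) D₂.X := h12.moduleFinite hp2 hg₂ ha₂ hκ hγ D₂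
  haveI : Module.Finite (IwasawaAlgebra p) D₃.X := h12.moduleFinite hp2 hg₃ ha₃ hκ hγ D₃
  haveI : Module.Finite (IwasawaAlgebra p) D₄.X := h12.moduleFinite hp2 hg₄ ha₄ hκ hγ D₄
  obtain ⟨n₂, hK₂⟩ := h41.exists_dvd_pow_mul hp2 hg₂ ha₂ Dm₂.isNewformOf hκ hγ hγ'
    (hPP₂.isSignedPAdicLFunction_kobayashiL ε) D₂ (h12.isTorsion hp2 hg₂ ha₂ hκ hγ D₂) hg₂'
  obtain ⟨n₃, hK₃⟩ := h41.exists_dvd_pow_mul hp2 hg₃ ha₃ c3 hκ hγ hγ'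
    (hPP₃.isSignedPAdicLFunction_kobayashiL ε) D₃ (h12.isTorsion hp2 hg₃ ha₃ hκ hγ D₃) hg₃'
  obtain ⟨n₄, hK₄⟩ := h41.exists_dvd_pow_mul hp2 hg₄ ha₄ Dm₄.isNewformOf hκ hγ hγ'
    (hPP₄.isSignedPAdicLFunction_kobayashiL ε) D₄ (h12.isTorsion hp2 hg₄ ha₄ hκ hγ D₄) hg₄'
  rw [SmallImageMuPinning.natCast_pow_mul_eq_C_pow_mul] at hK₂ hK₃ hK₄
  -- cancel the three auxiliary `L`'s: `L₁ ∣ p^{n₂+n₃+n₄} g₁`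
  exact ⟨g₁, n₂ + n₃ + n₄, hg₁',
    SmallImageMuPinning.dvd_C_pow_mul_of_mul4_dvd (kobayashiL_ne_zero hPP₂ ε) (kobayashiL_ne_zero hPP₃ ε)
      (kobayashiL_ne_zero hPP₄ ε) hK₂ hK₃ hK₄ hprod⟩

/-- **The INTEGRAL Eisenstein half `KobayashiLowerDivisibility W p ε` from the K1″ package and ONE analytic
`μ`-value — NO image hypothesis.** Same by-name inputs plus the published period unit
(`realPeriodRat_eq_unit_mul_plusPeriod`: `ord_p(Ω⁺_f/Ω_E) = 0` at `p ≥ 5`); for an X7 pair `(W, p)`, `p ≥ 5`,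
carrying the K1″ package, and a sign `ε` at which **`μ(L_p^ε(E)) = 0`** (`X1.MuLambda.mu`, for every newform
of `E` and Pollack pair — by uniqueness, ONE number): `KobayashiLowerDivisibility W p ε`. Proof: §4's rational
half `L_p^ε ∣ p^t g` is integral when `μ(L_p^ε) = 0` (`MuSplit.dvd_of_dvd_C_pow_mul_of_mu_eq_zero'`), and the
period ratio `ϖ` is a `p`-adic unit (`padicValRat_periodRatio_eq_zero_of_five_le`), so `ι g = ϖ · ι(L^ε · h)`.
On item 4's domain (`ρ̄` not onto) this is birth's registered `stub_lowerSmallImage` at the sign `ε`, modulo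
the package and the one-sign analytic `μ`-rider of `E` itself — the `μ`'s of the auxiliary twists and of the
Selmer side play no role; the EQUALITY (saturation) is not obtained.
[cite: Kobayashi2003, Conjecture (Main Conjecture) (p. 2), Thm. 1.2, Thm. 4.1 (p. 8)]
[cite: GreenbergVatsal2000, p. 4 and §3 Remark 3.4] [cite: Pollack2003, Conj. 6.3 (p. 548)]
[cite: BurungaleSkinnerTianWan2024, §2.3 proof of Thm. (KoMC_r) (arXiv v2 TeX store p0076 L36–L65) (assembly only; OPEN binders)] -/
theorem kobayashiLowerDivisibility_of_package_of_mu_noSurj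
    (h422 : prop422_greenbergAnyRoot_hasUnitContent_minus)
    (hpkg : props118_27_519_exists_signedTwoVariablePackage_supersingular_PRE) :
    Literature.NumberTheory.EllipticCurves.Kobayashi2003.thm41_signedCharIdeal_divisibility → Literature.NumberTheory.EllipticCurves.Kobayashi2003.thm12_signedSelmerDual_finite_torsion → Literature.NumberTheory.EllipticCurves.ModularForms.nonempty_modularParametrizationData → Literature.NumberTheory.EllipticCurves.realPeriodRat_eq_unit_mul_plusPeriod → Literature.NumberTheory.EllipticCurves.BurungaleSkinnerTianWan2024.thm617_exists_commonKatzFrame_isGreenbergLFunctionAnyRoot₂_supersingular_PRE → ∀ (W : WeierstrassCurve ℚ) [W.IsElliptic] [W.IsGloballyMinimal] (p : ℕ) [Fact p.Prime], 5 ≤ p → Literature.NumberTheory.EllipticCurves.Rank1Residual.ClassX7 W p → (∃ (K : Type) (_ : Field K) (_ : NumberField K) (ι : PadicAlgCl p ≃+* ℂ) (v vbar : IsDedekindDomain.HeightOneSpectrum (NumberField.RingOfIntegers K)) (κ₁ κ₂ : Literature.NumberTheory.EllipticCurves.ZpExtension K p) (γ₁ γ₂ : Field.absoluteGaloisGroup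 K) (_ : Fact (Literature.NumberTheory.EllipticCurves.ZpExtension.IsTopGeneratorPair κ₁ κ₂ γ₁ γ₂)) (_ : NeZero (NumberField.discr K).natAbs) (N : ℕ) (_ : NeZero N) (f : CuspForm (CongruenceSubgroup.Gamma0 N) 2) (d : ℤ) (W' : WeierstrassCurve ℚ) (_ : W'.IsElliptic) (_ : W'.IsGloballyMinimal) (C : WeierstrassCurve.VariableChange ℚ) (N' : ℕ) (_ : NeZero N') (f' : CuspForm (CongruenceSubgroup.Gamma0 N') 2), Literature.NumberTheory.EllipticCurves.ModularForms.IsNewformOf W f ∧ (N : ℤ) = W.conductorNorm ℤ ∧ Literature.NumberTheory.EllipticCurves.ModularForms.IsNewformOf W' f' ∧ (N' : ℤ) = W'.conductorNorm ℤ ∧ Squarefree d ∧ 1 < d ∧ (∀ q : ℕ, q.Prime → Literature.NumberTheory.EllipticCurves.BurungaleSkinnerTianWan2024.RamifiedInQuadratic d q → q ≠ p ∧ ¬ q ∣ N ∧ ¬ (q : ℤ) ∣ NumberField.discr K) ∧ C • W' = W.quadraticTwist (d : ℚ) ∧ Literature.NumberTheory.EllipticCurves.IsImaginaryQuadratic K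 ∧ ((Ideal.span {(p : ℤ)}).primesOver (NumberField.RingOfIntegers K)).ncard = 2 ∧ ((p : ℕ) : NumberField.RingOfIntegers K) ∈ v.asIdeal ∧ ((p : ℕ) : NumberField.RingOfIntegers K) ∈ vbar.asIdeal ∧ vbar ≠ v ∧ (∀ (w : NumberField.InfinitePlace K) (k : NumberField.RingOfIntegers K), k ∈ v.asIdeal ↔ ‖ι.symm (w.embedding (k : K))‖ < 1) ∧ IsCoprime (N : ℤ) (NumberField.discr K) ∧ (∀ ℓ : ℕ, ℓ.Prime → ℓ ∣ N → ((Ideal.span {(ℓ : ℤ)}).primesOver (NumberField.RingOfIntegers K)).ncard = 2) ∧ (∀ ℓ : ℕ, ℓ.Prime → (ℓ : ℤ) ∣ d → ((Ideal.span {(ℓ : ℤ)}).primesOver (NumberField.RingOfIntegers K)).ncard = 2) ∧ ((Ideal.span {(2 : ℤ)}).primesOver (NumberField.RingOfIntegers K)).ncard = 2 ∧ (∀ ρ : Literature.NumberTheory.GaloisRepresentations.ModPGaloisRep K (ZMod p) 2, (W.baseChange K).IsTorsionGaloisRep p ρ → Literature.NumberTheory.GaloisRepresentations.FramedRep.IsAbsolutelyIrreducible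 ρ) ∧ κ₁.IsCyclotomic ∧ κ₂.IsAnticyclotomic ∧ (∃ ζ : ℤ_[p]ˣ, IsOfFinOrder ζ ∧ ((Literature.NumberTheory.GaloisRepresentations.GaloisRep.cyclotomicCharacter K p γ₁ * ζ : ℤ_[p]ˣ) : ℤ_[p]) = (Literature.NumberTheory.EllipticCurves.cyclotomicGenerator p : ℤ_[p])) ∧ ∀ (Ω δ : ℂ) (Ωp : (Literature.NumberTheory.EllipticCurves.unrIntegers p)ˣ) (LK G G' : PowerSeries (PowerSeries (PadicComplexInt p))), Ω ≠ 0 → (δ ^ 2 = (NumberField.discr K : ℂ) ∨ δ ^ 2 = -(NumberField.discr K : ℂ)) → Literature.NumberTheory.EllipticCurves.IsKatzMeasure₂ ι v vbar ∅ κ₁ κ₂ γ₁⁻¹ γ₂⁻¹ 1 Ω δ ((Ωp : Literature.NumberTheory.EllipticCurves.unrIntegers p) : PadicComplex p) LK → Literature.NumberTheory.EllipticCurves.IsGreenbergLFunctionAnyRoot₂ ι v vbar κ₁ κ₂ γ₁⁻¹ γ₂⁻¹ f (NumberField.discr K).natAbs (NumberField.classNumber K) LK G → Literature.NumberTheory.EllipticCurves.IsGreenbergLFunctionAnyRoot₂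 ι v vbar κ₁ κ₂ γ₁⁻¹ γ₂⁻¹ f' (NumberField.discr K).natAbs (NumberField.classNumber K) LK G' → ∀ J : ℤ_[p] →+* PadicComplexInt p, (∀ x : ℤ_[p], ((J x : PadicComplexInt p) : PadicComplex p) = ((x : ℚ_[p]) : PadicComplex p)) → ∃ s : PowerSeries (PadicComplexInt p), s ≠ 0 ∧ Ideal.span {PowerSeries.map (PowerSeries.C (R := PadicComplexInt p)) s} * ((WeierstrassCurve.XGr₂.charIdeal (W.baseChange K) p κ₁ κ₂ vbar γ₁ γ₂).map (Literature.NumberTheory.EllipticCurves.IwasawaAlgebra₂.toUnr₂ p J) * (WeierstrassCurve.XGr₂.charIdeal (W'.baseChange K) p κ₁ κ₂ vbar γ₁ γ₂).map (Literature.NumberTheory.EllipticCurves.IwasawaAlgebra₂.toUnr₂ p J)) ≤ Ideal.span {G * G'}) →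
    ∀ ε : ℤˣ,
      (∀ {M : ℕ} [NeZero M] (f : CuspForm (Gamma0 M) 2), IsNewformOf W f →
        ∀ (Lplus Lminus : IwasawaAlgebra p), IsPollackPair f p Lplus Lminus →
          Summit.BirchSwinnertonDyer.Rank1Residual.X1.MuLambda.mu (kobayashiL ε Lplus Lminus) = 0) →
      Summit.BirchSwinnertonDyer.Rank1Residual.Supersingular.KobayashiLowerDivisibility W p ε := by
  intro h41 h12 hmodP h5 hGF W _ _ p _ hp5 hX hP ε hμE κ γ hκ hγ hγ' _ f hf ϖ hϖ Lp Lm hPP D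
  have hp2 : p ≠ 2 := by omega
  obtain ⟨g, t, hchar, hdvd⟩ :=
    rationalLowerDivisibility_of_package_noSurj h422 hpkg h41 h12 hmodP hGF W p hp5 hX hP ε κ γ hκ hγ hγ' f hf
      Lp Lm hPP D
  -- integral, since `μ(L_p^ε) = 0`
  obtain ⟨k, hk⟩ : kobayashiL ε Lp Lm ∣ g :=
    MuSplit.dvd_of_dvd_C_pow_mul_of_mu_eq_zero' (hμE f hf Lp Lm hPP) hdvd
  -- Néron normalisation: `ϖ` is a `p`-adic unit
  have hϖ0 : ϖ ≠ 0 := hf.periodRatio_ne_zero hϖ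
  have hvϖ : padicValRat p ϖ = 0 :=
    padicValRat_periodRatio_eq_zero_of_five_le h5 W p hp5 hX.1.1 (ClassX7.irr W p hp2 hX) f hf ϖ hϖ
  obtain ⟨u, hu⟩ := exists_units_coe_eq_ratCast hϖ0 hvϖ
  refine ⟨g, PowerSeries.C ((u⁻¹ : ℤ_[p]ˣ) : ℤ_[p]) * k, hchar, ?_⟩
  refine (MuSplit.iota_eq_C_mul_iota_iff u hu g _).mpr ?_
  calc g = kobayashiL ε Lp Lm * k := hk
    _ = (PowerSeries.C (u : ℤ_[p]) * PowerSeries.C ((u⁻¹ : ℤ_[p]ˣ) : ℤ_[p])) * (kobayashiL ε Lp Lm * k) := by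
        rw [← map_mul, Units.mul_inv, map_one, one_mul]
    _ = PowerSeries.C (u : ℤ_[p]) * (kobayashiL ε Lp Lm * (PowerSeries.C ((u⁻¹ : ℤ_[p]ˣ) : ℤ_[p]) * k)) := by
        ring

end Summit.BirchSwinnertonDyer.BirchSwinnertonDyer.Theorems.SmallImageAcnsDescent

end
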